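import Summits.MatrixMultiplication.OmegaCensus.STPP211Z2pow6DirectChunks

/-!
# (2,1,1)¹⁰ ⊄ (ℤ/2)⁶ — part S2 class 05, decisions 2/4: direct search over the hard class #17 of `reps29` (roots d = 10 (part))

Cell `pub-omega` (unit `pub-omega-stpp-1-g37`), topic `Summits/MatrixMultiplication/OmegaCensus`.
HONEST FRAMING (verbatim): lottery ticket; floor = certified bounds/negative ranges. Census STRUCTURE bookkeeping (B5, `T1((ℤ/2)⁶)`, Pb237);
nothing here is a bound on `ω`.

Class #17 of `reps29` in the translated form `C' = hc05 = [0, 1, 3, 5, 9, 15, 17, 22, 33, 38]` (`+ 1`, block of `c = 1` first; linear stabilizer of order 128,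
root representatives [2, 6, 10, 11, 18, 26, 58]; HOME `pub-omega-stpp-1-g36/code/hard_perd.json`). The kernel evaluates the direct engine
(`STPP211Z2pow6DirectEngine.rootD`, soundness `noNF_of_rootD`) in CHUNKS of the root node (`STPP211Z2pow6DirectChunks.rootDX`, ≤ 10⁵ search
calls each, exact counts from the seat's C mirror `godc.c`; this file: 795,328 calls) and assembles `rootD C' d = true` per root by
`rootD_of_chunks`. The class theorem follows in `STPP211Z2pow6Hard05Class` (symmetry transport, `STPP211Z2pow6DirectTransport`).

References: H. Cohn, R. Kleinberg, B. Szegedy, C. Umans, FOCS 2005 (arXiv:math/0511460), Def. 5.1.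
-/

namespace Summit.MatrixMultiplication.OmegaCensus

namespace T1CosetEng

/-- KERNEL: root `d = 10`, chunk 1 (codes `x = 0 … 6` of the branching label's lane; 125,337 search calls). -/
theorem hc05_d10_c1 : rootDX [0, 1, 3, 5, 9, 15, 17, 22, 33, 38] 10 127 = true := by decide +kernel

/-- KERNEL: root `d = 10`, chunk 2 (codes `x = 7 … 7` of the branching label's lane; 117,137 search calls). -/
theorem hc05_d10_c2 : rootDX [0, 1, 3, 5, 9, 15, 17, 22, 33, 38] 10 128 = true := by decide +kernel

/-- KERNEL: root `d = 10`, chunk 3 (codes `x = 8 … 12` of the branching label's lane; 94,003 search calls). -/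
theorem hc05_d10_c3 : rootDX [0, 1, 3, 5, 9, 15, 17, 22, 33, 38] 10 7936 = true := by decide +kernel

/-- KERNEL: root `d = 10`, chunk 4 (codes `x = 13 … 13` of the branching label's lane; 90,279 search calls). -/
theorem hc05_d10_c4 : rootDX [0, 1, 3, 5, 9, 15, 17, 22, 33, 38] 10 8192 = true := by decide +kernel

/-- KERNEL: root `d = 10`, chunk 5 (codes `x = 14 … 18` of the branching label's lane; 81,806 search calls). -/
theorem hc05_d10_c5 : rootDX [0, 1, 3, 5, 9, 15, 17, 22, 33, 38] 10 507904 = true := by decide +kernel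

/-- KERNEL: root `d = 10`, chunk 6 (codes `x = 19 … 19` of the branching label's lane; 78,476 search calls). -/
theorem hc05_d10_c6 : rootDX [0, 1, 3, 5, 9, 15, 17, 22, 33, 38] 10 524288 = true := by decide +kernel

/-- KERNEL: root `d = 10`, chunk 7 (codes `x = 20 … 20` of the branching label's lane; 66,934 search calls). -/
theorem hc05_d10_c7 : rootDX [0, 1, 3, 5, 9, 15, 17, 22, 33, 38] 10 1048576 = true := by decide +kernel

/-- KERNEL: root `d = 10`, chunk 8 (codes `x = 21 … 21` of the branching label's lane; 69,708 search calls). -/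
theorem hc05_d10_c8 : rootDX [0, 1, 3, 5, 9, 15, 17, 22, 33, 38] 10 2097152 = true := by decide +kernel

/-- KERNEL: root `d = 10`, chunk 9 (codes `x = 22 … 24` of the branching label's lane; 71,648 search calls). -/
theorem hc05_d10_c9 : rootDX [0, 1, 3, 5, 9, 15, 17, 22, 33, 38] 10 29360128 = true := by decide +kernel

end T1CosetEng

end Summit.MatrixMultiplication.OmegaCensus
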